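import Summits.CriticalPhenomena.CardyFormulaZ2.Theorems.CardySusyWardWeakHolomorphyReduction
import Summits.CriticalPhenomena.CardyFormulaZ2.Theorems.CardySusyWardWeakHolomorphyAliasSplit
import Summits.CriticalPhenomena.CardyFormulaZ2.Theorems.CardySusyWardWeakHolomorphySpinShift

/-!
# `WeakHolomorphy ⟸ ParafermionBulkBound ∧ RelativeAliasFloor` — the split glue of the line `alias-floor`
# for the crux `CardySusyWard.WeakHolomorphy` (stmt-CriticalPhenomena-11292), sorry-free

Landed by lead prover `prover-line-stmt-CriticalPhenomena-11292-c4-0` (2026-08-17); the mathematics and the Lean text are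
the crux-strategist's `Cruxes/WeakHolomorphy/SplitGlue.lean` (`planner-cstrat-stmt-CriticalPhenomena-11292-s1-0`,
2026-08-17), moved VERBATIM into the prover-only `Theorems/` tree under the namespace
`Summit.CriticalPhenomena.CardyFormulaZ2.Theorems.WeakHolomorphy.AliasFloor` so that the line's skeleton
(`Cruxes/WeakHolomorphy/Lines/alias_floor.lean`) and a route-level split
(`ledger route edit route-CriticalPhenomena-CardySusyWard --split WeakHolomorphy --into children.json --glue-by
…Theorems.WeakHolomorphy.AliasFloor.WeakHolomorphy_of_subs`, children.json in `Cruxes/WeakHolomorphy/Lines/alias-floor.md`)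
can import it.

The two children, both in the ROUTE'S OWN vocabulary (the bisector-convention vertex observable
`F^{(s)}_δ(z) = ∫ passageSum (medialExploration (Λ δ) ω) δ s z dP_{1/2}` at the spin `s = 1/3` and at its square-lattice
alias `s = −5/3`):
* `ParafermionBulkBound` — VERBATIM clause (i) of the route's rank-3 crux `ParafermionPrecompact` (stmt-11293):
  eventually `‖F^{(1/3)}_δ(z)‖ ≤ C δ^{1/3}` above every compact (`parafermionBulkBound_of_precompact`: projection);
* `RelativeAliasFloor` — `∀ ε > 0`, eventually `‖F^{(−5/3)}_δ(z)‖ ≤ ε (‖F^{(1/3)}_δ(z)‖ + δ^{1/3})` at every medial vertex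
  above the compact.
Glue: `stub_staggeredKirchhoffEqSpinShift` (`K_p = ± Σ_k F^{(−5/3)}(c_{p,k})`, `…WeakHolomorphySpinShift`),
`stub_aliasVertexEqSumEventually` (`Σ_k F^{(−5/3)}(c_{p,k}) = 2cos(5π/12) F^{(−5/3)}_δ(z_p)` eventually above compacts,
`…WeakHolomorphyAliasSplit`), `stub_count`, `weakHolomorphy_of_kirchhoffL1` (`…WeakHolomorphyReduction`, p137519).
So, relative to what the route already owes (stmt-11293), the crux IS the pointwise relative alias floor
(`WeakHolomorphy_of_precompact_of_relativeAlias`).  What is deliberately NOT here: any claim on either child (both are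
open; the second is crux-grade — `Cruxes/WeakHolomorphy/STRATEGY-CENSUS.md` §1, §Decomposition D5, §Negation N5).
References: Duminil-Copin–Smirnov arXiv:1109.1549 §8.3 (Prop. 8.6, Conj. 8.7); Smirnov, Ann. Math. 172 (2010) §4.
-/

noncomputable section

namespace Summit.CriticalPhenomena.CardyFormulaZ2.Theorems.WeakHolomorphy.AliasFloor

open scoped BigOperators Topology
open Filter Set MeasureTheory
open _root_.Literature.Probability.LatticeModels
open _root_.Literature.Probability.RandomPlanarGeometry (DobrushinDomain)
open _root_.Literature.Probability.Percolation (bondPercolation half)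
open _root_.Literature.Barriers.CriticalPhenomena (medialCornersAt medialVertexOf)
open Summit.CriticalPhenomena.CardyFormulaZ2.Theorems.ParafermionPrecompact.Negative (IsFamily)
open Summit.CriticalPhenomena.CardyFormulaZ2.Theorems.WeakHolomorphy.SplitBypass

/-- Arithmetic of the exponents: `δ^{1/3} / δ² = δ^{-5/3}` for `δ > 0`. [folklore] -/
theorem rpow_third_div_sq {δ : ℝ} (hδ : 0 < δ) : δ ^ ((1:ℝ) / 3) / δ ^ 2 = δ ^ (-(5:ℝ) / 3) := by
  rw [div_eq_mul_inv, ← Real.rpow_natCast δ 2, ← Real.rpow_neg hδ.le, ← Real.rpow_add hδ]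
  norm_num

/-- **The two stubs give the `L¹` Kirchhoff law of the spin-`1/3` dart observable** (the hypothesis of the landed
`weakHolomorphy_of_kirchhoffL1`; no sorry).  Per vertex above `K`, eventually
`‖K_p‖ = ‖Σ_k F^{(−5/3)}(c_{p,k})‖ = 2cos(5π/12) ‖F^{(−5/3)}_δ(z_p)‖ ≤ 2cos(5π/12) ε (|C|+1) δ^{1/3}`; summing over the
`≤ C_K δ^{-2}` medial vertices above `K` gives `Σ_{p ∈ S} ‖K_p‖ ≤ ε' δ^{-5/3}`.
[cite: DuminilCopinSmirnov2012Lattice, §8.3, Conjecture 8.7] -/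
theorem kirchhoffL1_of_subs
    (hbulk : ∀ (D : Literature.Probability.RandomPlanarGeometry.DobrushinDomain) (Λ : ℝ → Literature.Probability.LatticeModels.DiscreteDobrushin), (∀ δ, (Λ δ).Ω = D.carrier) → (∀ δ, (Λ δ).δ = δ) → Filter.Tendsto (fun δ : ℝ => Metric.hausdorffEDist (Λ δ).arcA (D.arc 0)) (nhdsWithin (0:ℝ) (Set.Ioi 0)) (nhds 0) → Filter.Tendsto (fun δ : ℝ => Metric.hausdorffEDist (Λ δ).arcB (D.arc 1)) (nhdsWithin (0:ℝ) (Set.Ioi 0)) (nhds 0) → Filter.Tendsto (fun δ : ℝ => Metric.hausdorffEDist (Literature.Probability.LatticeModels.medialPoint δ '' (Λ δ).zdABEdges) {D.pt 0, D.pt 1}) (nhdsWithin (0:ℝ) (Set.Ioi 0)) (nhds 0) → (∀ᶠ δ in nhdsWithin (0:ℝ) (Set.Ioi 0), (Λ δ).IsZdAdmissible) → ∀ K : Set ℂ, IsCompact K → K ⊆ D.carrier → ∃ C : ℝ, ∀ᶠ δ in nhdsWithin (0:ℝ) (Set.Ioi 0), ∀ z : Literature.Probability.LatticeModels.MedialVertex,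 Literature.Probability.LatticeModels.medialPoint δ z ∈ K → ‖(∫ ω, Literature.Probability.LatticeModels.MedialPath.passageSum (Literature.Probability.LatticeModels.medialExploration (Λ δ) ω) δ (1 / 3) z ∂(Literature.Probability.Percolation.bondPercolation (Literature.Probability.LatticeModels.zdGraph 2) Literature.Probability.Percolation.half))‖ ≤ C * δ ^ ((1:ℝ) / 3))
    (halias : ∀ (D : Literature.Probability.RandomPlanarGeometry.DobrushinDomain) (Λ : ℝ → Literature.Probability.LatticeModels.DiscreteDobrushin), (∀ δ, (Λ δ).Ω = D.carrier) → (∀ δ, (Λ δ).δ = δ) → Filter.Tendsto (fun δ : ℝ => Metric.hausdorffEDist (Λ δ).arcA (D.arc 0)) (nhdsWithin (0:ℝ) (Set.Ioi 0)) (nhds 0) → Filter.Tendsto (fun δ : ℝ => Metric.hausdorffEDist (Λ δ).arcB (D.arc 1)) (nhdsWithin (0:ℝ) (Set.Ioi 0)) (nhds 0) → Filter.Tendsto (fun δ : ℝ => Metric.hausdorffEDist (Literature.Probability.LatticeModels.medialPoint δ '' (Λ δ).zdABEdges) {D.pt 0, D.pt 1}) (nhdsWithin (0:ℝ) (Set.Ioi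 0)) (nhds 0) → (∀ᶠ δ in nhdsWithin (0:ℝ) (Set.Ioi 0), (Λ δ).IsZdAdmissible) → ∀ K : Set ℂ, IsCompact K → K ⊆ D.carrier → ∀ ε > (0:ℝ), ∀ᶠ δ in nhdsWithin (0:ℝ) (Set.Ioi 0), ∀ z : Literature.Probability.LatticeModels.MedialVertex, Literature.Probability.LatticeModels.medialPoint δ z ∈ K → ‖(∫ ω, Literature.Probability.LatticeModels.MedialPath.passageSum (Literature.Probability.LatticeModels.medialExploration (Λ δ) ω) δ (-5 / 3) z ∂(Literature.Probability.Percolation.bondPercolation (Literature.Probability.LatticeModels.zdGraph 2) Literature.Probability.Percolation.half))‖ ≤ ε * (‖(∫ ω, Literature.Probability.LatticeModels.MedialPath.passageSum (Literature.Probability.LatticeModels.medialExploration (Λ δ) ω) δ (1 / 3) z ∂(Literature.Probability.Percolation.bondPercolation (Literature.Probability.LatticeModels.zdGraph 2) Literature.Probability.Percolation.half))‖ + δ ^ ((1:ℝ) / 3))) :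
    ∀ (D : DobrushinDomain) (Λ : ℝ → DiscreteDobrushin), IsFamily D Λ →
      ∀ (K : Set ℂ), IsCompact K → K ⊆ D.carrier → ∀ ε > (0:ℝ), ∀ᶠ δ in 𝓝[>] (0:ℝ),
        ∀ S : Finset (Site 2 × Fin 2), (∀ p ∈ S, medialPoint δ (medialVertexOf p) ∈ K) →
          ∑ p ∈ S, ‖bondDartObservable (Λ δ) δ (1 / 3) (medialCornersAt p.1 p.2 1) +
              bondDartObservable (Λ δ) δ (1 / 3) (medialCornersAt p.1 p.2 3) -
              bondDartObservable (Λ δ) δ (1 / 3) (medialCornersAt p.1 p.2 0) -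
              bondDartObservable (Λ δ) δ (1 / 3) (medialCornersAt p.1 p.2 2)‖ ≤ ε * δ ^ (-(5:ℝ) / 3) := by
  intro D Λ hfam K hK hKD ε hε
  obtain ⟨hΩ, hδ, hA, hB, hAB, hadm⟩ := hfam
  obtain ⟨C, hC⟩ := hbulk D Λ hΩ hδ hA hB hAB hadm K hK hKD
  obtain ⟨C₀, hC₀⟩ := stub_count K hK
  -- the positive constant of the alias split
  set A : ℝ := 2 * Real.cos (((-5 : ℝ) / 3) * Real.pi / 4) with hAdef
  have hApos : 0 < A := two_cos_alias_pos
  -- the auxiliary tolerance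
  set ε' : ℝ := ε / (A * (|C| + 1) * (|C₀| + 1)) with hε'def
  have hden : 0 < A * (|C| + 1) * (|C₀| + 1) := by positivity
  have hε' : 0 < ε' := div_pos hε hden
  have hal := halias D Λ hΩ hδ hA hB hAB hadm K hK hKD ε' hε'
  have hsplit := stub_aliasVertexEqSumEventually D Λ ⟨hΩ, hδ, hA, hB, hAB, hadm⟩ K hK hKD
  have hlt1 : ∀ᶠ δ in nhdsWithin (0:ℝ) (Set.Ioi 0), δ < 1 :=
    (eventually_lt_nhds zero_lt_one).filter_mono nhdsWithin_le_nhds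
  filter_upwards [hC, hal, hsplit, hadm, hlt1, self_mem_nhdsWithin] with δ hCδ halδ hsplitδ hadmδ hδ1 hδpos
  intro S hS
  have hδpos' : (0:ℝ) < δ := hδpos
  obtain ⟨sgn, hsgn, hspin⟩ := stub_staggeredKirchhoffEqSpinShift (Λ δ) hadmδ
  have hsgn1 : ‖sgn‖ = 1 := by rcases hsgn with h | h <;> simp [h]
  -- per-vertex bound
  have hterm : ∀ p ∈ S,
      ‖bondDartObservable (Λ δ) δ (1 / 3) (medialCornersAt p.1 p.2 1) +
          bondDartObservable (Λ δ) δ (1 / 3) (medialCornersAt p.1 p.2 3) -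
          bondDartObservable (Λ δ) δ (1 / 3) (medialCornersAt p.1 p.2 0) -
          bondDartObservable (Λ δ) δ (1 / 3) (medialCornersAt p.1 p.2 2)‖ ≤
        A * (ε' * ((|C| + 1) * δ ^ ((1:ℝ) / 3))) := by
    intro p hp
    have hpK := hS p hp
    rw [hspin p δ hδpos'.ne', norm_mul, hsgn1, one_mul, ← hsplitδ p hpK, norm_mul, Complex.norm_real,
      Real.norm_of_nonneg hApos.le]
    refine mul_le_mul_of_nonneg_left ?_ hApos.le
    refine (halδ (medialVertexOf p) hpK).trans ?_
    refine mul_le_mul_of_nonneg_left ?_ hε'.le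
    have h1 := hCδ (medialVertexOf p) hpK
    have h2 : C * δ ^ ((1:ℝ) / 3) ≤ |C| * δ ^ ((1:ℝ) / 3) :=
      mul_le_mul_of_nonneg_right (le_abs_self C) (by positivity)
    nlinarith [h1, h2, Real.rpow_nonneg hδpos'.le ((1:ℝ) / 3)]
  -- counting
  obtain ⟨S₀, hS₀, hcard⟩ := hC₀ δ hδpos' hδ1.le
  have hsub : S ⊆ S₀ := fun p hp => hS₀ p (Metric.self_subset_cthickening K (hS p hp))
  have hcardS : (S.card : ℝ) ≤ C₀ / δ ^ 2 := by
    rw [le_div_iff₀ (by positivity), mul_comm]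
    exact (mul_le_mul_of_nonneg_left (by exact_mod_cast Finset.card_le_card hsub) (by positivity)).trans hcard
  have hC₀nn : 0 ≤ C₀ := le_trans (by positivity) hcard
  -- summation
  calc ∑ p ∈ S, ‖bondDartObservable (Λ δ) δ (1 / 3) (medialCornersAt p.1 p.2 1) +
            bondDartObservable (Λ δ) δ (1 / 3) (medialCornersAt p.1 p.2 3) -
            bondDartObservable (Λ δ) δ (1 / 3) (medialCornersAt p.1 p.2 0) -
            bondDartObservable (Λ δ) δ (1 / 3) (medialCornersAt p.1 p.2 2)‖
      ≤ ∑ p ∈ S, A * (ε' * ((|C| + 1) * δ ^ ((1:ℝ) / 3))) := Finset.sum_le_sum hterm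
    _ = (S.card : ℝ) * (A * (ε' * ((|C| + 1) * δ ^ ((1:ℝ) / 3)))) := by
        rw [Finset.sum_const, nsmul_eq_mul]
    _ ≤ (C₀ / δ ^ 2) * (A * (ε' * ((|C| + 1) * δ ^ ((1:ℝ) / 3)))) :=
        mul_le_mul_of_nonneg_right hcardS (by positivity)
    _ = ε * (C₀ / (|C₀| + 1)) * (δ ^ ((1:ℝ) / 3) / δ ^ 2) := by
        rw [hε'def]
        field_simp
    _ ≤ ε * 1 * (δ ^ ((1:ℝ) / 3) / δ ^ 2) := by
        gcongr
        rw [div_le_one (by positivity)]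
        exact (le_abs_self C₀).trans (le_add_of_nonneg_right zero_le_one)
    _ = ε * δ ^ (-(5:ℝ) / 3) := by rw [mul_one, rpow_third_div_sq hδpos']

/-- **The split glue with explicit hypotheses `WeakHolomorphy ⟸ Sub₁ ∧ Sub₂`** (both children spelled out in the route's
vocabulary — the form a route-level `--split WeakHolomorphy --into ParafermionBulkBound RelativeAliasFloor --glue-by` would
consume). [cite: DuminilCopinSmirnov2012Lattice, Conjecture 8.7] -/
theorem WeakHolomorphy_of_subs
    (hbulk : ∀ (D : Literature.Probability.RandomPlanarGeometry.DobrushinDomain) (Λ : ℝ → Literature.Probability.LatticeModels.DiscreteDobrushin), (∀ δ, (Λ δ).Ω = D.carrier) → (∀ δ, (Λ δ).δ = δ) → Filter.Tendsto (fun δ : ℝ => Metric.hausdorffEDist (Λ δ).arcA (D.arc 0)) (nhdsWithin (0:ℝ) (Set.Ioi 0)) (nhds 0) → Filter.Tendsto (fun δ : ℝ => Metric.hausdorffEDist (Λ δ).arcB (D.arc 1)) (nhdsWithin (0:ℝ) (Set.Ioi 0)) (nhds 0) → Filter.Tendsto (fun δ : ℝ => Metric.hausdorffEDist (Literature.Probability.LatticeModels.medialPoint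 δ '' (Λ δ).zdABEdges) {D.pt 0, D.pt 1}) (nhdsWithin (0:ℝ) (Set.Ioi 0)) (nhds 0) → (∀ᶠ δ in nhdsWithin (0:ℝ) (Set.Ioi 0), (Λ δ).IsZdAdmissible) → ∀ K : Set ℂ, IsCompact K → K ⊆ D.carrier → ∃ C : ℝ, ∀ᶠ δ in nhdsWithin (0:ℝ) (Set.Ioi 0), ∀ z : Literature.Probability.LatticeModels.MedialVertex, Literature.Probability.LatticeModels.medialPoint δ z ∈ K → ‖(∫ ω, Literature.Probability.LatticeModels.MedialPath.passageSum (Literature.Probability.LatticeModels.medialExploration (Λ δ) ω) δ (1 / 3) z ∂(Literature.Probability.Percolation.bondPercolation (Literature.Probability.LatticeModels.zdGraph 2) Literature.Probability.Percolation.half))‖ ≤ C * δ ^ ((1:ℝ) / 3))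
    (halias : ∀ (D : Literature.Probability.RandomPlanarGeometry.DobrushinDomain) (Λ : ℝ → Literature.Probability.LatticeModels.DiscreteDobrushin), (∀ δ, (Λ δ).Ω = D.carrier) → (∀ δ, (Λ δ).δ = δ) → Filter.Tendsto (fun δ : ℝ => Metric.hausdorffEDist (Λ δ).arcA (D.arc 0)) (nhdsWithin (0:ℝ) (Set.Ioi 0)) (nhds 0) → Filter.Tendsto (fun δ : ℝ => Metric.hausdorffEDist (Λ δ).arcB (D.arc 1)) (nhdsWithin (0:ℝ) (Set.Ioi 0)) (nhds 0) → Filter.Tendsto (fun δ : ℝ => Metric.hausdorffEDist (Literature.Probability.LatticeModels.medialPoint δ '' (Λ δ).zdABEdges) {D.pt 0, D.pt 1}) (nhdsWithin (0:ℝ) (Set.Ioi 0)) (nhds 0) → (∀ᶠ δ in nhdsWithin (0:ℝ) (Set.Ioi 0), (Λ δ).IsZdAdmissible) → ∀ K : Set ℂ, IsCompact K → K ⊆ D.carrier → ∀ ε > (0:ℝ), ∀ᶠ δ in nhdsWithin (0:ℝ) (Set.Ioi 0), ∀ z : Literature.Probability.LatticeModels.MedialVertex, Literature.Probability.LatticeModels.medialPoint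 δ z ∈ K → ‖(∫ ω, Literature.Probability.LatticeModels.MedialPath.passageSum (Literature.Probability.LatticeModels.medialExploration (Λ δ) ω) δ (-5 / 3) z ∂(Literature.Probability.Percolation.bondPercolation (Literature.Probability.LatticeModels.zdGraph 2) Literature.Probability.Percolation.half))‖ ≤ ε * (‖(∫ ω, Literature.Probability.LatticeModels.MedialPath.passageSum (Literature.Probability.LatticeModels.medialExploration (Λ δ) ω) δ (1 / 3) z ∂(Literature.Probability.Percolation.bondPercolation (Literature.Probability.LatticeModels.zdGraph 2) Literature.Probability.Percolation.half))‖ + δ ^ ((1:ℝ) / 3))) :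
    Summit.CriticalPhenomena.CardyFormulaZ2.Theses.CardySusyWard.WeakHolomorphy :=
  weakHolomorphy_of_kirchhoffL1 (kirchhoffL1_of_subs hbulk halias)

/-- **`ParafermionPrecompact` (i) is the first stub, by projection** (route item stmt-11293 ⟹ `stub_parafermionBulkBound`).
[cite: DuminilCopinSmirnov2012Lattice, Conjecture 8.7] -/
theorem parafermionBulkBound_of_precompact
    (h : Summit.CriticalPhenomena.CardyFormulaZ2.Theses.CardySusyWard.ParafermionPrecompact) :
    ∀ (D : Literature.Probability.RandomPlanarGeometry.DobrushinDomain) (Λ : ℝ → Literature.Probability.LatticeModels.DiscreteDobrushin), (∀ δ, (Λ δ).Ω = D.carrier) → (∀ δ, (Λ δ).δ = δ) → Filter.Tendsto (fun δ : ℝ => Metric.hausdorffEDist (Λ δ).arcA (D.arc 0)) (nhdsWithin (0:ℝ) (Set.Ioi 0)) (nhds 0) → Filter.Tendsto (fun δ : ℝ => Metric.hausdorffEDist (Λ δ).arcB (D.arc 1)) (nhdsWithin (0:ℝ) (Set.Ioi 0)) (nhds 0) → Filter.Tendsto (fun δ : ℝ => Metric.hausdorffEDist (Literature.Probability.LatticeModels.medialPoint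 δ '' (Λ δ).zdABEdges) {D.pt 0, D.pt 1}) (nhdsWithin (0:ℝ) (Set.Ioi 0)) (nhds 0) → (∀ᶠ δ in nhdsWithin (0:ℝ) (Set.Ioi 0), (Λ δ).IsZdAdmissible) → ∀ K : Set ℂ, IsCompact K → K ⊆ D.carrier → ∃ C : ℝ, ∀ᶠ δ in nhdsWithin (0:ℝ) (Set.Ioi 0), ∀ z : Literature.Probability.LatticeModels.MedialVertex, Literature.Probability.LatticeModels.medialPoint δ z ∈ K → ‖(∫ ω, Literature.Probability.LatticeModels.MedialPath.passageSum (Literature.Probability.LatticeModels.medialExploration (Λ δ) ω) δ (1 / 3) z ∂(Literature.Probability.Percolation.bondPercolation (Literature.Probability.LatticeModels.zdGraph 2) Literature.Probability.Percolation.half))‖ ≤ C * δ ^ ((1:ℝ) / 3) :=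
  fun D Λ h1 h2 h3 h4 h5 h6 K hK hKD => (h D Λ h1 h2 h3 h4 h5 h6 K hK hKD).1

/-- **Within the route: `WeakHolomorphy ⟸ ParafermionPrecompact ∧ stub_relativeAliasFloor`.**
[cite: DuminilCopinSmirnov2012Lattice, Conjecture 8.7] -/
theorem WeakHolomorphy_of_precompact_of_relativeAlias
    (hpre : Summit.CriticalPhenomena.CardyFormulaZ2.Theses.CardySusyWard.ParafermionPrecompact)
    (halias : ∀ (D : Literature.Probability.RandomPlanarGeometry.DobrushinDomain) (Λ : ℝ → Literature.Probability.LatticeModels.DiscreteDobrushin), (∀ δ, (Λ δ).Ω = D.carrier) → (∀ δ, (Λ δ).δ = δ) → Filter.Tendsto (fun δ : ℝ => Metric.hausdorffEDist (Λ δ).arcA (D.arc 0)) (nhdsWithin (0:ℝ) (Set.Ioi 0)) (nhds 0) → Filter.Tendsto (fun δ : ℝ => Metric.hausdorffEDist (Λ δ).arcB (D.arc 1)) (nhdsWithin (0:ℝ) (Set.Ioi 0)) (nhds 0) → Filter.Tendsto (fun δ : ℝ => Metric.hausdorffEDist (Literature.Probability.LatticeModels.medialPoint δ '' (Λ δ).zdABEdges)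 {D.pt 0, D.pt 1}) (nhdsWithin (0:ℝ) (Set.Ioi 0)) (nhds 0) → (∀ᶠ δ in nhdsWithin (0:ℝ) (Set.Ioi 0), (Λ δ).IsZdAdmissible) → ∀ K : Set ℂ, IsCompact K → K ⊆ D.carrier → ∀ ε > (0:ℝ), ∀ᶠ δ in nhdsWithin (0:ℝ) (Set.Ioi 0), ∀ z : Literature.Probability.LatticeModels.MedialVertex, Literature.Probability.LatticeModels.medialPoint δ z ∈ K → ‖(∫ ω, Literature.Probability.LatticeModels.MedialPath.passageSum (Literature.Probability.LatticeModels.medialExploration (Λ δ) ω) δ (-5 / 3) z ∂(Literature.Probability.Percolation.bondPercolation (Literature.Probability.LatticeModels.zdGraph 2) Literature.Probability.Percolation.half))‖ ≤ ε * (‖(∫ ω, Literature.Probability.LatticeModels.MedialPath.passageSum (Literature.Probability.LatticeModels.medialExploration (Λ δ) ω) δ (1 / 3) z ∂(Literature.Probability.Percolation.bondPercolation (Literature.Probability.LatticeModels.zdGraph 2) Literature.Probability.Percolation.half))‖ + δ ^ ((1:ℝ) / 3))) :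
    Summit.CriticalPhenomena.CardyFormulaZ2.Theses.CardySusyWard.WeakHolomorphy :=
  WeakHolomorphy_of_subs (parafermionBulkBound_of_precompact hpre) halias

/-- **`stub_weakHolomorphyOfSubs`** (registered stub of stmt-CriticalPhenomena-11292; `WeakHolomorphy_of_subs` with the two
children as explicit antecedents): `ParafermionBulkBound → RelativeAliasFloor → WeakHolomorphy` — the split glue of the line
`alias-floor` as ONE named implication. [cite: DuminilCopinSmirnov2012Lattice, Conjecture 8.7] -/
theorem stub_weakHolomorphyOfSubs : (∀ (D : Literature.Probability.RandomPlanarGeometry.DobrushinDomain) (Λ : ℝ → Literature.Probability.LatticeModels.DiscreteDobrushin), (∀ δ, (Λ δ).Ω = D.carrier) → (∀ δ, (Λ δ).δ = δ) → Filter.Tendsto (fun δ : ℝ => Metric.hausdorffEDist (Λ δ).arcA (D.arc 0)) (nhdsWithin (0:ℝ) (Set.Ioi 0)) (nhds 0) → Filter.Tendsto (fun δ : ℝ => Metric.hausdorffEDist (Λ δ).arcB (D.arc 1)) (nhdsWithin (0:ℝ) (Set.Ioi 0)) (nhds 0) → Filter.Tendsto (fun δ : ℝ => Metric.hausdorffEDist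 (Literature.Probability.LatticeModels.medialPoint δ '' (Λ δ).zdABEdges) {D.pt 0, D.pt 1}) (nhdsWithin (0:ℝ) (Set.Ioi 0)) (nhds 0) → (∀ᶠ δ in nhdsWithin (0:ℝ) (Set.Ioi 0), (Λ δ).IsZdAdmissible) → ∀ K : Set ℂ, IsCompact K → K ⊆ D.carrier → ∃ C : ℝ, ∀ᶠ δ in nhdsWithin (0:ℝ) (Set.Ioi 0), ∀ z : Literature.Probability.LatticeModels.MedialVertex, Literature.Probability.LatticeModels.medialPoint δ z ∈ K → ‖(∫ ω, Literature.Probability.LatticeModels.MedialPath.passageSum (Literature.Probability.LatticeModels.medialExploration (Λ δ) ω) δ (1 / 3) z ∂(Literature.Probability.Percolation.bondPercolation (Literature.Probability.LatticeModels.zdGraph 2) Literature.Probability.Percolation.half))‖ ≤ C * δ ^ ((1:ℝ) / 3)) → (∀ (D : Literature.Probability.RandomPlanarGeometry.DobrushinDomain) (Λ : ℝ → Literature.Probability.LatticeModels.DiscreteDobrushin), (∀ δ, (Λ δ).Ω = D.carrier) → (∀ δ, (Λ δ).δ = δ) → Filter.Tendsto (fun δ : ℝ => Metric.hausdorffEDist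 (Λ δ).arcA (D.arc 0)) (nhdsWithin (0:ℝ) (Set.Ioi 0)) (nhds 0) → Filter.Tendsto (fun δ : ℝ => Metric.hausdorffEDist (Λ δ).arcB (D.arc 1)) (nhdsWithin (0:ℝ) (Set.Ioi 0)) (nhds 0) → Filter.Tendsto (fun δ : ℝ => Metric.hausdorffEDist (Literature.Probability.LatticeModels.medialPoint δ '' (Λ δ).zdABEdges) {D.pt 0, D.pt 1}) (nhdsWithin (0:ℝ) (Set.Ioi 0)) (nhds 0) → (∀ᶠ δ in nhdsWithin (0:ℝ) (Set.Ioi 0), (Λ δ).IsZdAdmissible) → ∀ K : Set ℂ, IsCompact K → K ⊆ D.carrier → ∀ ε > (0:ℝ), ∀ᶠ δ in nhdsWithin (0:ℝ) (Set.Ioi 0), ∀ z : Literature.Probability.LatticeModels.MedialVertex, Literature.Probability.LatticeModels.medialPoint δ z ∈ K → ‖(∫ ω, Literature.Probability.LatticeModels.MedialPath.passageSum (Literature.Probability.LatticeModels.medialExploration (Λ δ) ω) δ (-5 / 3) z ∂(Literature.Probability.Percolation.bondPercolation (Literature.Probability.LatticeModels.zdGraph 2) Literature.Probability.Percolation.half))‖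 ≤ ε * (‖(∫ ω, Literature.Probability.LatticeModels.MedialPath.passageSum (Literature.Probability.LatticeModels.medialExploration (Λ δ) ω) δ (1 / 3) z ∂(Literature.Probability.Percolation.bondPercolation (Literature.Probability.LatticeModels.zdGraph 2) Literature.Probability.Percolation.half))‖ + δ ^ ((1:ℝ) / 3))) → Summit.CriticalPhenomena.CardyFormulaZ2.Theses.CardySusyWard.WeakHolomorphy :=
  fun hbulk halias => WeakHolomorphy_of_subs hbulk halias

/-- **`stub_weakHolomorphyOfPrecompactOfRelativeAlias`** (registered stub of stmt-CriticalPhenomena-11292): within the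
route, `ParafermionPrecompact → RelativeAliasFloor → WeakHolomorphy` — given the route's rank-3 crux (stmt-11293) the crux
IS the pointwise relative alias floor. [cite: DuminilCopinSmirnov2012Lattice, Conjecture 8.7] -/
theorem stub_weakHolomorphyOfPrecompactOfRelativeAlias : Summit.CriticalPhenomena.CardyFormulaZ2.Theses.CardySusyWard.ParafermionPrecompact → (∀ (D : Literature.Probability.RandomPlanarGeometry.DobrushinDomain) (Λ : ℝ → Literature.Probability.LatticeModels.DiscreteDobrushin), (∀ δ, (Λ δ).Ω = D.carrier) → (∀ δ, (Λ δ).δ = δ) → Filter.Tendsto (fun δ : ℝ => Metric.hausdorffEDist (Λ δ).arcA (D.arc 0)) (nhdsWithin (0:ℝ) (Set.Ioi 0)) (nhds 0) → Filter.Tendsto (fun δ : ℝ => Metric.hausdorffEDist (Λ δ).arcB (D.arc 1)) (nhdsWithin (0:ℝ) (Set.Ioi 0)) (nhds 0) → Filter.Tendsto (fun δ : ℝ => Metric.hausdorffEDist (Literature.Probability.LatticeModels.medialPoint δ '' (Λ δ).zdABEdges) {D.pt 0, D.pt 1}) (nhdsWithin (0:ℝ) (Set.Ioi 0)) (nhds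 0) → (∀ᶠ δ in nhdsWithin (0:ℝ) (Set.Ioi 0), (Λ δ).IsZdAdmissible) → ∀ K : Set ℂ, IsCompact K → K ⊆ D.carrier → ∀ ε > (0:ℝ), ∀ᶠ δ in nhdsWithin (0:ℝ) (Set.Ioi 0), ∀ z : Literature.Probability.LatticeModels.MedialVertex, Literature.Probability.LatticeModels.medialPoint δ z ∈ K → ‖(∫ ω, Literature.Probability.LatticeModels.MedialPath.passageSum (Literature.Probability.LatticeModels.medialExploration (Λ δ) ω) δ (-5 / 3) z ∂(Literature.Probability.Percolation.bondPercolation (Literature.Probability.LatticeModels.zdGraph 2) Literature.Probability.Percolation.half))‖ ≤ ε * (‖(∫ ω, Literature.Probability.LatticeModels.MedialPath.passageSum (Literature.Probability.LatticeModels.medialExploration (Λ δ) ω) δ (1 / 3) z ∂(Literature.Probability.Percolation.bondPercolation (Literature.Probability.LatticeModels.zdGraph 2) Literature.Probability.Percolation.half))‖ + δ ^ ((1:ℝ) / 3))) → Summit.CriticalPhenomena.CardyFormulaZ2.Theses.CardySusyWard.WeakHolomorphy :=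
  fun hpre halias => WeakHolomorphy_of_precompact_of_relativeAlias hpre halias

end Summit.CriticalPhenomena.CardyFormulaZ2.Theorems.WeakHolomorphy.AliasFloor

end
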